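import Literature.AlgebraicGeometry.HodgeTheory.WeilClasses
import Literature.AlgebraicGeometry.HodgeTheory.WeilClassesFourfolds
import Literature.AlgebraicGeometry.HodgeTheory.HodgeConjecture
import Literature.AlgebraicGeometry.Motives.HyperbolicWeilType
import Literature.AlgebraicGeometry.Motives.AbelianVarietyProjectiveChart
import Literature.AlgebraicGeometry.Motives.SupersingularAbelianVariety
import Literature.AlgebraicGeometry.HodgeTheory.ComplexConjugationHolds
import HarnessLib

/-!
# The Hodge conjecture for all POWERS of discriminant-1 Weil fourfolds (Floccari–Fu 2026) and the refereed discriminant-1 fourfold floor (Markman 2023)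

Two NAMED FACTS (no proofs), both REFEREED theorems in print, recorded on the tree's real carriers in
the binder shape of `HodgeTheory/WeilClassesSixfolds` (`Markman2025_weilClasses_algebraic_hyperbolicSixfold`):

* `FloccariFu2026_hodgeClasses_algebraic_powers_discOneWeilFourfold : Prop` — S. Floccari, L. Fu, *The Hodge
  conjecture for Weil fourfolds with discriminant 1 via singular OG6-varieties*, J. Math. Pures Appl.
  210 (2026) 103876 = arXiv:2504.13607 [`FloccariFu2026`], **Theorem 1.2** (p. 3 of the held text,
  verbatim): "The Hodge conjecture holds for all powers of any abelian fourfold of Weil type with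
  discriminant 1." (ibid.: "Theorem 1.1 was strengthened by the first author in [floccari25], as
  follows" — the statement is Floccari's, the paper gives a second proof "via a direct geometric
  relation between abelian fourfolds of Weil type with discriminant 1 and the six-dimensional
  hyper-Kähler varieties K̃ of O'Grady type", p. 2.) Rendering: for `d ≥ 1`, `A` a complex abelian
  FOURFOLD with `φ ≫ φ = -(d • 𝟙 A)` (`K = ℚ(√-d) ↪ End⁰ A`), a projective embedding `ι` and a rational
  `a ≠ 0` in `H²(ℙᴺ(ℂ); ℂ)` with `(A, φ)` of HYPERBOLIC Weil type for the `K`-symmetrised hyperplane class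
  `h = d·ι^*a + φ^*ι^*a` — for `n = 2`, hyperbolic `⟺ det H = (-1)² = 1 ⟺` "discriminant 1"
  (dictionary (3) of `Motives/HyperbolicWeilType`; van Geemen LNM 1594 Lemma 5.2/5.4) — the FULL
  cycle statement (every rational `(p,p)`-class algebraic) holds for every self-power `A^(k+1) = A.powSucc k` (in its own
  dimension `4(k+1)`; `Motives.AbelianVariety.powSucc`, `A.powSucc 0 = A`).
* `Markman2023_weilClasses_algebraic_discOneWeilFourfold : Prop` — E. Markman, *The monodromy of
  generalized Kummer varieties and algebraic cycles on their intermediate Jacobians*, J. Eur. Math.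
  Soc. 25 (2023) 231–321 = arXiv:1805.11574 [`Markman2023GeneralizedKummers`], **Theorem 1.5 (= Theorem 13.4),
  p. 236 of the printed JEMS text = Theorem 1.3 (§1.2, p. 5–6) of the held pre-v4 arXiv text**, verbatim:
  "Let `(A,K,h)` be a polarized abelian fourfold of Weil type of discriminant
  `1`. Then the `3`-dimensional subspace [of `H^{2,2}(A,ℚ)` spanned by `h²` and `⋀⁴_K H¹(A,ℚ)`] consists
  of algebraic classes." (= Floccari–Fu's Theorem 1.1.) Rendering: same binders, conclusion restricted
  to the Weil plane `weilClassesOf A φ 2 d` (the `h²` summand is a divisor monomial, algebraic by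
  Lefschetz (1,1), not restated) — i.e. the discriminant-1 SLICE of the (unrefereed, all-discriminant)
  fourfold fact `Markman2025_weilClasses_algebraic_abelianFourfold` of `HodgeTheory/WeilClassesFourfolds`.

## Faithfulness to print (conventions of `WeilClassesFourfolds` / `WeilClassesSixfolds`)
* "of Weil type with discriminant 1" ↦ `φ ≫ φ = -(d • 𝟙 A)` with `√-d ∈ End(A)` (an order of `K` acts —
  a restriction of the family, never more than print) and `Motives.IsHyperbolicWeilType A φ 2 h` for a
  `K`-symmetrised hyperplane class `h` (hyperbolic ⟹ `K` acts with multiplicities `(2,2)`, the tree's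
  `finrank_eigenspace_inf_hodgeOneZero_eq_of_isHyperbolicWeilType`; for a polarization class Witt index
  `2 ⟺ det H = 1`). Every `φ`-compatible polarization class is of the form `(2d)⁻¹(d L + φ^* L)`, so the
  symmetrised classes exhaust print's `h` up to `ℚ^×_{>0}` (hyperbolicity is scale-invariant).
* "all powers" ↦ `∀ k p`, every rational `(p,p)`-class on `A.powSucc k` is algebraic — the CYCLE PART of
  the tree's own predicate `HodgeConjectureFor (A.powSucc k).dim (A.powSucc k).X` for the iterated binary
  product (its Hodge-model conjunct is the tree's theorem `nonempty_hodgeModel_holds`;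
  `hodgeConjectureFor_powSucc_of_floccariFu` gives the full predicate); `A⁰ = pt` is omitted (trivial).
* Upper bounds: both facts are instances of "`HodgeConjectureFor` for all smooth projective varieties"
  (`…_of_hodgeConjectureFor` below), so nothing beyond the summit statement is asserted; the arrows
  F5 → F00 (`k = 0`) and F1 → F00 (slice) are proved here.

What the hyper-Kähler method gives BEYOND Weil classes of discriminant-1 fourfolds is therefore: ALL
Hodge classes on ALL powers `A^(k+1)` — abelian varieties of dimension `4(k+1) ≥ 8` for `k ≥ 1`, outside
the dimension-`≤ 5` range of `AbelianLowDimensionHodgeConjecture` — and nothing off discriminant 1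
(arXiv:1805.11574 §1.2: the Kummer-type intermediate Jacobians "all have trivial discriminant").
Consumers: the b2b `hweil` ladder (rung "R5 — generalized-Kummer / hyper-Kähler relatives" = these two
floor facts; cite work-item wi-42356); any route decl on powers of Weil fourfolds.
-/

noncomputable section

open CategoryTheory

namespace Literature.AlgebraicGeometry.HodgeTheory

open Literature.AlgebraicTopology.SingularHomology

section HodgeTheory

/-- **Floccari–Fu 2026 (JMPA 210, 103876 = arXiv:2504.13607), Theorem 1.2 — every Hodge class on every
power of an abelian fourfold of Weil type with discriminant 1 is algebraic** (a THEOREM in print, refereed;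
statement first proved by Floccari, [floccari25] loc. cit.; print's one-sentence statement is quoted
verbatim in the module docstring). Rendering: for `d ≥ 1`, a complex abelian fourfold `A` with
`φ ≫ φ = -(d • 𝟙 A)`, hyperbolic (= discriminant `1 = (-1)²`) for a `K`-symmetrised hyperplane class,
every `k` and every `p`, every rational class of Hodge type `(p,p)` in `H²ᵖ` of the self-power
`A.powSucc k` (= `A^(k+1)`, dimension parameter `(A.powSucc k).dim = 4(k+1)`) lies in
`algebraicClasses (A.powSucc k).X p` — the cycle part of the summit layer's predicate for `A^(k+1)` (the
Hodge-model conjunct is the tree's theorem `nonempty_hodgeModel_holds`; the assembling theorem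
`…_powSucc_of_floccariFu` below gives the full predicate). [cite: FloccariFu2026, Theorem 1.2] -/
def FloccariFu2026_hodgeClasses_algebraic_powers_discOneWeilFourfold : Prop :=
  ∀ (d : ℕ), 0 < d → ∀ (A : Motives.AbelianVariety ℂ) (φ : A ⟶ A), A.dim = 2 * 2 →
    φ ≫ φ = -(d • 𝟙 A) →
      ∀ (e : Motives.ProjectiveEmbedding A.X)
        (a : complexBetti (Motives.projectiveSpace e.n ℂ) 2), IsRationalClass a → a ≠ 0 →
        Motives.IsHyperbolicWeilType A φ 2
          ((d : ℂ) • complexBetti.map e.ι 2 a +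
            complexBetti.map φ.hom.hom.hom 2 (complexBetti.map e.ι 2 a)) →
          ∀ (k p : ℕ) (c : complexBetti (A.powSucc k).X (2 * p)), IsRationalClass c →
            IsOfHodgeType (A.powSucc k).dim (A.powSucc k).X (2 * p) p p c →
              c ∈ algebraicClasses (A.powSucc k).X p

/-- **Markman 2023 (JEMS 25 (2023) 231–321, Theorem 1.5 = Theorem 13.4, p. 236; = Theorem 1.3 of the held pre-v4
arXiv text 1805.11574): "Let `(A,K,h)` be a polarized abelian fourfold
of Weil type of discriminant `1`. Then the `3`-dimensional subspace of `H^{2,2}(A,ℚ)` spanned by `h²` and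
`⋀⁴_K H¹(A,ℚ)` consists of algebraic classes."** (a THEOREM in print, refereed; = Floccari–Fu's Theorem
1.1.) Weil-plane part on the real carriers: under the binders of the Floccari–Fu fact (plus smooth
projectivity of `A.X` in dimension `4`, which holds for every abelian variety), every rational
`(2,2)`-class of `weilClassesOf A φ 2 d` is algebraic.
[cite: Markman2023GeneralizedKummers, Theorem 1.5 (= Theorem 13.4), p. 236; pre-v4 arXiv text: Theorem 1.3] -/
def Markman2023_weilClasses_algebraic_discOneWeilFourfold : Prop :=
  ∀ (d : ℕ), 0 < d → ∀ (A : Motives.AbelianVariety ℂ) (φ : A ⟶ A), A.dim = 2 * 2 →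
    Motives.IsSmoothProjective (2 * 2) A.X → φ ≫ φ = -(d • 𝟙 A) →
      ∀ (e : Motives.ProjectiveEmbedding A.X)
        (a : complexBetti (Motives.projectiveSpace e.n ℂ) 2), IsRationalClass a → a ≠ 0 →
        Motives.IsHyperbolicWeilType A φ 2
          ((d : ℂ) • complexBetti.map e.ι 2 a +
            complexBetti.map φ.hom.hom.hom 2 (complexBetti.map e.ι 2 a)) →
          ∀ c : complexBetti A.X (2 * 2), IsRationalClass c →
            IsOfHodgeType (2 * 2) A.X (2 * 2) 2 2 c → c ∈ weilClassesOf A φ 2 d →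
              c ∈ algebraicClasses A.X 2

/-! ### Upper bounds: both facts are instances of the Hodge conjecture -/

/-- `HodgeConjectureFor` for all smooth projective varieties implies the Floccari–Fu fact: each self-power
`A.powSucc k` is a smooth projective variety of dimension `(A.powSucc k).dim`
(`Motives.AbelianVariety.isSmoothProjective_holds`), and the fact is the cycle part there. [cite: Deligne2000, §1] -/
theorem FloccariFu2026_hodgeClasses_algebraic_powers_discOneWeilFourfold_of_hodgeConjectureFor
    (h : ∀ ⦃n : ℕ⦄ ⦃X : Motives.SchemeOver ℂ⦄, Motives.IsSmoothProjective n X → HodgeConjectureFor n X) :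
    FloccariFu2026_hodgeClasses_algebraic_powers_discOneWeilFourfold :=
  fun _ _ A _ _ _ _ _ _ _ _ k p c hc hpp ↦
    (h (Motives.AbelianVariety.isSmoothProjective_holds (A := A.powSucc k))).2 p c hc hpp

/-- `HodgeConjectureFor` for all smooth projective varieties implies the Markman 2023 fact (its instance on
hyperbolic abelian fourfolds, restricted to the Weil plane). [cite: Deligne2000, §1] -/
theorem Markman2023_weilClasses_algebraic_discOneWeilFourfold_of_hodgeConjectureFor
    (h : ∀ ⦃n : ℕ⦄ ⦃X : Motives.SchemeOver ℂ⦄, Motives.IsSmoothProjective n X → HodgeConjectureFor n X) :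
    Markman2023_weilClasses_algebraic_discOneWeilFourfold :=
  fun _ _ _ _ _ hX _ _ _ _ _ _ c hc h22 _ ↦ (h hX).2 2 c hc h22

/-! ### Consequence: the summit layer's predicate for every power -/

/-- With the tree's theorem that smooth projective varieties have Hodge models
(`nonempty_hodgeModel_holds`), the Floccari–Fu fact gives the full summit-layer predicate
`HodgeConjectureFor` for every self-power `A^(k+1)` of a discriminant-1 Weil fourfold, in its own
dimension. [cite: FloccariFu2026, Theorem 1.2] -/
theorem hodgeConjectureFor_powSucc_of_floccariFu
    (h5 : FloccariFu2026_hodgeClasses_algebraic_powers_discOneWeilFourfold) {d : ℕ} (hd : 0 < d)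
    (A : Motives.AbelianVariety ℂ) (φ : A ⟶ A) (hA : A.dim = 2 * 2) (hφ : φ ≫ φ = -(d • 𝟙 A))
    (e : Motives.ProjectiveEmbedding A.X) (a : complexBetti (Motives.projectiveSpace e.n ℂ) 2)
    (ha : IsRationalClass a) (ha0 : a ≠ 0)
    (hyp : Motives.IsHyperbolicWeilType A φ 2
      ((d : ℂ) • complexBetti.map e.ι 2 a + complexBetti.map φ.hom.hom.hom 2 (complexBetti.map e.ι 2 a)))
    (k : ℕ) : HodgeConjectureFor (A.powSucc k).dim (A.powSucc k).X :=
  ⟨nonempty_hodgeModel_holds (Motives.AbelianVariety.isSmoothProjective_holds (A := A.powSucc k)),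
    fun p c hc hpp ↦ h5 d hd A φ hA hφ e a ha ha0 hyp k p c hc hpp⟩

/-! ### Arrows: F5 → F00 (`k = 0`) and F1 → F00 (discriminant-1 slice) -/

/-- Floccari–Fu at `k = 0` (`A.powSucc 0 = A`) gives the full Hodge conjecture for the discriminant-1
fourfold itself, in particular Markman's 2023 theorem on its Weil classes. [folklore] -/
theorem Markman2023_weilClasses_algebraic_discOneWeilFourfold_of_floccariFu
    (h5 : FloccariFu2026_hodgeClasses_algebraic_powers_discOneWeilFourfold) :
    Markman2023_weilClasses_algebraic_discOneWeilFourfold := by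
  intro d hd A φ hA _hX hφ e a ha ha0 hyp c hc hpq _hw
  have h0 : ∀ (p : ℕ) (c : complexBetti A.X (2 * p)), IsRationalClass c →
      IsOfHodgeType A.dim A.X (2 * p) p p c → c ∈ algebraicClasses A.X p :=
    h5 d hd A φ hA hφ e a ha ha0 hyp 0
  rw [hA] at h0
  exact h0 2 c hc hpq

/-- The all-discriminant fourfold fact of `WeilClassesFourfolds` (Markman 2025, unrefereed) implies its
discriminant-1 slice (Markman 2023, refereed): the hyperbolicity hypothesis is simply dropped. [folklore] -/
theorem Markman2023_weilClasses_algebraic_discOneWeilFourfold_of_markman2025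
    (h1 : Markman2025_weilClasses_algebraic_abelianFourfold) :
    Markman2023_weilClasses_algebraic_discOneWeilFourfold :=
  fun d hd A φ hA hX hφ _ _ _ _ _ c hc hpq hw ↦ h1 d hd A φ hA hX hφ c hc hpq hw

/-! ### Sanity on the carriers -/

/-- `A.powSucc 0 = A`: the `k = 0` instance of the Floccari–Fu fact speaks about `A` itself. [folklore] -/
theorem powSucc_zero_dim (A : Motives.AbelianVariety ℂ) : (A.powSucc 0).dim = A.dim := rfl

/-- The zero class is a Weil class of every `(A, φ, 2, d)` and is algebraic: the Markman 2023 fact is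
consistent on its trivially inhabited instance. [folklore] -/
theorem zero_mem_weilClassesOf_two_and_algebraicClasses (A : Motives.AbelianVariety ℂ) (φ : A ⟶ A)
    (d : ℕ) : (0 : complexBetti A.X (2 * 2)) ∈ weilClassesOf A φ 2 d ∧
      (0 : complexBetti A.X (2 * 2)) ∈ algebraicClasses A.X 2 :=
  ⟨Submodule.zero_mem _, Submodule.zero_mem _⟩

end HodgeTheory

end Literature.AlgebraicGeometry.HodgeTheory

end
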